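import Literature.AlgebraicGeometry.Resolution.PermissibleBlowupDirectrix
import Literature.AlgebraicGeometry.Resolution.BlowupsProperProofs
import Literature.AlgebraicGeometry.Resolution.PointBlowupHsFunMono
import Literature.RingTheory.HilbertSamuel.HilbertSamuelCompletion
import HarnessLib

/-!
# `ē` does not increase at near points of a permissible blow-up (consequences of CJS Thm. 3.10 (4))

Topic: `Literature/AlgebraicGeometry/Resolution`. PROVED consequences (no new premise) of the named
fact `CossartJannsenSaito2020_thm_3_10_4` (`PermissibleBlowupDirectrix.lean`; Cossart–Jannsen–Saito,
LNM 2270 (2020), Thm. 3.10 (4): "for any field extension `K/k(x')` one has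
`e_{x'}(X')_K ≤ e_x(X)_K − δ_{x'/x}`" at a near point `x'` of the blow-up in a permissible centre
`D ∋ x`):

* `dirDimOver_le_of_hsFun_eq` — the fact with `δ` dropped: `e_{x'}(X')_K ≤ e_x(X)_K`;
* `geomDirDim_le_of_hsFun_eq` — **`ē_{x'}(X') ≤ ē_x(X)`** when `k(x')` is algebraic (integral) over
  `k(x)`: then an algebraic closure `K` of `k(x')` is an algebraic closure of `k(x)`, and
  `e_x(X)_K = ē_x(X)` (CJS Def. 2.21, tree `geomDirDim_eq_dirDimOver`);
* `geomDirDim_le_of_hsFun_eq_of_isClosed` — the same at a CLOSED point `x'` of `X'` (a blow-up of a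
  locally noetherian scheme is of finite type, so `k(x')/k(π x')` is finite, Stacks 01TB, tree
  `finite_residueFieldMap_of_isClosed`).

These are the forms consumed by the Hilbert–Samuel route of the summit ResolutionOfSingularities
(«`ē` does not increase along a canonical near step», `…Theorems.CampaignW42.GeomDirDimNonincrease`,
`…Theorems.SigmaMaxModificationsCorridor3.Helpers.ClosedOriginGeomDirDimNonincrease`).

## Sources

* V. Cossart, U. Jannsen, S. Saito, LNM 2270 (2020), Thm. 3.10 (4), Def. 2.21, Def. 2.26.
  [CossartJannsenSaito2020]
* The Stacks Project, Tag 01TB. [StacksProject]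
-/

noncomputable section

open CategoryTheory AlgebraicGeometry TopologicalSpace IsLocalRing
open Literature.RingTheory.HilbertSamuel

namespace Literature.AlgebraicGeometry.Resolution

universe u


section Consequences

variable {X X' : Scheme.{u}} [IsLocallyNoetherian X] [IsLocallyNoetherian X'] {π : X' ⟶ X}
  {D : X.IdealSheafData}

/-- **`e_{x'}(X')_K ≤ e_x(X)_K` at a near point** (the fact with `δ` dropped), for every field `K`
over `k(x')` regarded over `k(x)` through `π`. [cite: CossartJannsenSaito2020, Thm. 3.10 (4)] -/
theorem dirDimOver_le_of_hsFun_eq (h : CossartJannsenSaito2020_thm_3_10_4.{u})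
    (hX : Scheme.IsExcellent X) (hD : IdealSheafData.IsPermissible D) (hπ : IsBlowup π D)
    {N : ℕ} (hN : topologicalKrullDim X ≤ (N : WithBot ℕ∞)) {x' : X'}
    (hx : π.base x' ∈ (D.support : Set X))
    (hnear : Scheme.hsFun X' N x' = Scheme.hsFun X N (π.base x'))
    (K : Type u) [Field K] [Algebra (ResidueField (X'.presheaf.stalk x')) K]
    [Algebra (ResidueField (X.presheaf.stalk (π.base x'))) K]
    (halg : ∀ a, algebraMap (ResidueField (X.presheaf.stalk (π.base x'))) K a =
      algebraMap (ResidueField (X'.presheaf.stalk x')) K ((π.residueFieldMap x').hom a)) :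
    Scheme.dirDimOver X' x' K ≤ Scheme.dirDimOver X (π.base x') K := by
  have := h X X' π D hX hD hπ N hN x' hx hnear K halg
  exact_mod_cast le_trans (self_le_add_right _ _) this

/-- **`ē_{x'}(X') ≤ ē_x(X)` at a near point `x'` over `x ∈ D` whose residue field is ALGEBRAIC over
`k(x)`** (then `δ_{x'/x} = 0`, and an algebraic closure of `k(x')` is an algebraic closure of
`k(x)`, over which `e_x(X)_K = ē_x(X)`, CJS Def. 2.21). [cite: CossartJannsenSaito2020, Thm. 3.10 (4), Def. 2.21] -/
theorem geomDirDim_le_of_hsFun_eq (h : CossartJannsenSaito2020_thm_3_10_4.{u})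
    (hX : Scheme.IsExcellent X) (hD : IdealSheafData.IsPermissible D) (hπ : IsBlowup π D)
    {N : ℕ} (hN : topologicalKrullDim X ≤ (N : WithBot ℕ∞)) {x' : X'}
    (hx : π.base x' ∈ (D.support : Set X))
    (hnear : Scheme.hsFun X' N x' = Scheme.hsFun X N (π.base x'))
    (hint : (π.residueFieldMap x').hom.IsIntegral) :
    Scheme.geomDirDim X' x' ≤ Scheme.geomDirDim X (π.base x') := by
  -- `K = k̄(x')`, an algebraic closure of `k(x')`, as a `k(x)`-algebra through `π`
  let k := ResidueField (X.presheaf.stalk (π.base x'))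
  let k' := ResidueField (X'.presheaf.stalk x')
  let K := AlgebraicClosure k'
  let φ : k →+* k' := (π.residueFieldMap x').hom
  letI algkk' : Algebra k k' := φ.toAlgebra
  -- `K` is then a `k`-algebra through `k'` (`AlgebraicClosure.instAlgebra`), in a scalar tower
  have halg : ∀ a, algebraMap k K a = algebraMap k' K (φ a) := fun a =>
    IsScalarTower.algebraMap_apply k k' K a
  -- `K` is algebraic over `k`: `k'/k` is integral (hypothesis) and `K/k'` is algebraic
  haveI : Algebra.IsIntegral k k' := ⟨fun a => hint a⟩
  haveI : Algebra.IsAlgebraic k k' := Algebra.IsIntegral.isAlgebraic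
  haveI : Algebra.IsAlgebraic k K := Algebra.IsAlgebraic.trans k k' K
  haveI : IsAlgClosure k K := ⟨inferInstance, inferInstance⟩
  -- the fact over `K`
  have hle : Scheme.dirDimOver X' x' K ≤ Scheme.dirDimOver X (π.base x') K :=
    dirDimOver_le_of_hsFun_eq h hX hD hπ hN hx hnear K halg
  -- `e_{x'}(X')_K = ē_{x'}(X')` by definition, `e_x(X)_K = ē_x(X)` since `K` is an algebraic closure of `k(x)`
  have h1 : Scheme.geomDirDim X' x' = Scheme.dirDimOver X' x' K := rfl
  have h2 : Scheme.geomDirDim X (π.base x') = Scheme.dirDimOver X (π.base x') K :=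
    geomDirDim_eq_dirDimOver (X.presheaf.stalk (π.base x')) K
  rw [h1, h2]
  exact hle

/-- **`ē_{x'}(X') ≤ ē_{π x'}(X)` at a CLOSED near point `x'` over the centre** (a closed point of
`X'` has residue field finite over `k(π x')`, Stacks 01TB — blow-ups of locally noetherian schemes
are of finite type). [cite: CossartJannsenSaito2020, Thm. 3.10 (4), Def. 2.21] [cite: StacksProject, Tag 01TB] -/
theorem geomDirDim_le_of_hsFun_eq_of_isClosed (h : CossartJannsenSaito2020_thm_3_10_4.{u})
    (hX : Scheme.IsExcellent X) (hD : IdealSheafData.IsPermissible D) (hπ : IsBlowup π D)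
    {N : ℕ} (hN : topologicalKrullDim X ≤ (N : WithBot ℕ∞)) {x' : X'}
    (hx : π.base x' ∈ (D.support : Set X)) (hcl : IsClosed ({x'} : Set X'))
    (hnear : Scheme.hsFun X' N x' = Scheme.hsFun X N (π.base x')) :
    Scheme.geomDirDim X' x' ≤ Scheme.geomDirDim X (π.base x') := by
  haveI : IsProper π := hπ.isProper
  exact geomDirDim_le_of_hsFun_eq h hX hD hπ hN hx hnear
    (finite_residueFieldMap_of_isClosed π hcl).to_isIntegral

end Consequences

end Literature.AlgebraicGeometry.Resolution

end
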